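import Summits.NavierStokesRegularity.NavierStokesRegularity.Theorems.TypeIQuarterGateQuarterLawTypeILinearPacking
import Summits.NavierStokesRegularity.NavierStokesRegularity.Theorems.TypeIQuarterGateQuarterLawTypeIBackwardWindow
import HarnessLib

/-!
# The loud set of the last parabolic window has VANISHING TOTAL LENGTH — and the K1-violator's
# portrait «unboundedly many, linearly packed, short» (crux stmt-NavierStokesRegularity-23726)

Helper file (`--supports stmt-NavierStokesRegularity-23726`, def-free), third of the packing series
(`…LinearPacking` p829693, `…ClusterLaw` p829736). As there, a centre `x` is `η`-loud at scale `r` when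
`∫_{T−r²}^{T}∫_{B_r(x)} |∇u|_F² ≥ η r`, and `N` denotes the cardinality of a `2r`-separated loud family.

* `card_mul_scale_le_of_window` — bookkeeping: if the last window carries `∫_{T−r²}^{T}∫‖curl u‖² ≤ δ`
  then `N · η r ≤ δ` (disjoint balls, whole-space div–curl bound).
* `loudLength_small` — along ANY classical Leray–Hopf solution on `[0,T)` from a rapidly decaying datum
  (no Type-I hypothesis): for every `η, ε > 0` there is `r₁ > 0` with `N · r ≤ ε` for every `2r`-separated
  `η`-loud family at every scale `0 < r ≤ r₁` — the total LENGTH `N r` of the loud set tends to zero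
  (finite dissipation ⟹ small terminal windows, tree `QuarterLawBackwardWindow.exists_window_lt`). The
  count is `o(1/r)`; K1 ⟺ `O(1)` (tree `quarterLawTypeI_iff_uniformConcentrationCountTypeI`).
* `violator_many_short` — the K1-VIOLATOR'S PORTRAIT in cell currency: along a Type-I blow-up of K1's
  class violating the quarter law there is ONE threshold `η > 0` at which (a) the separated loud count is
  unbounded as `r → 0` (contrapositive of the landed `stub_countQuarterLaw`), while (b) `N r → 0`
  (`loudLength_small`) and (c) at most `3M(A+1)/η` of the cells fit in any ball of radius `A r`
  (`linearPacking_of_isTypeIBlowup`): unboundedly many Type-I cells, strung out one-dimensionally over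
  ≫ `r`, of total length → 0 — the «collapsing filament `√(T−t) ≪ L(t) → 0`» enemy, kernel-checked.

HONEST FRAMING: a priori structure along ONE hypothetical solution / blow-up; K1 (23726 = 24108 ⟺ 23970)
and NS regularity remain OPEN; nothing about the summit is claimed. [folklore]
[cite: CaffarelliKohnNirenberg1982, §6] [cite: Seregin2014, Ch. 6 §6.3 Prop. 3.11 (i)]
-/

-- the summit-side namespace repeats a component by design (D-0017)
set_option linter.dupNamespace false

noncomputable section

namespace Summit.NavierStokesRegularity.NavierStokesRegularity.Theorems

namespace QuarterLawLinearPacking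

open Set MeasureTheory Function Metric Filter Topology
open scoped ENNReal NNReal
open Literature.Analysis.FluidPDE

variable {ν T : ℝ} {u : ℝ → EuclideanSpace ℝ (Fin 3) → EuclideanSpace ℝ (Fin 3)}
  {p : ℝ → EuclideanSpace ℝ (Fin 3) → ℝ}

/-! ### Bookkeeping: the window budget bounds `N · η r` -/

/-- **Window budget ⟹ length bound.** For a classical solution on `[0,T)` (`ν > 0`), Leray–Hopf: if
`0 ≤ T − r²` and the last window carries `∫_{T−r²}^{T}∫‖curl u‖² ≤ δ`, then every `2r`-separated family
`σ` of `η`-loud centres at scale `r` has `#σ · (η r) ≤ δ` (in `ℝ≥0∞`). [folklore] -/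
theorem card_mul_scale_le_of_window (hν : 0 < ν)
    (hsol : IsClassicalNSSolutionOn (Ico 0 T) ν 0 u p) (hLH : IsLerayHopfOn T ν 0 (u 0) u)
    {r : ℝ} (hr2 : 0 ≤ T - r ^ 2) {δ : ℝ≥0∞}
    (hwin : ∫⁻ s in Ioo (T - r ^ 2) T, ∫⁻ x, ‖curl (u s) x‖ₑ ^ 2 ≤ δ) {η : ℝ}
    (σ : Finset (EuclideanSpace ℝ (Fin 3)))
    (hsep : ∀ x ∈ σ, ∀ x' ∈ σ, x ≠ x' → 2 * r ≤ ‖x - x'‖)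
    (hconc : ∀ x ∈ σ, ENNReal.ofReal (η * r) ≤ ∫⁻ s in Ioo (T - r ^ 2) T, ∫⁻ y in ball x r,
      ENNReal.ofReal (frobeniusNormSq (fderiv ℝ (u s) y))) :
    (σ.card : ℝ≥0∞) * ENNReal.ofReal (η * r) ≤ δ := by
  classical
  rcases σ.eq_empty_or_nonempty with hσ | hσ
  · simp [hσ]
  -- with a loud centre present, `0 < r` is automatic unless `η r ≤ 0`, in which case the claim is trivial
  by_cases hηr : η * r ≤ 0
  · rw [ENNReal.ofReal_of_nonpos hηr, mul_zero]; exact bot_le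
  push Not at hηr
  have hdisj : Set.PairwiseDisjoint (↑σ : Set (EuclideanSpace ℝ (Fin 3))) (fun x => ball x r) := by
    intro x hx x' hx' hne
    have h2 : 2 * r ≤ dist x x' := by rw [dist_eq_norm]; exact hsep x hx x' hx' hne
    exact ball_disjoint_ball (by linarith)
  set F : ℝ → EuclideanSpace ℝ (Fin 3) → ℝ≥0∞ := fun s y =>
    ENNReal.ofReal (frobeniusNormSq (fderiv ℝ (u s) y)) with hF
  have hlow : (σ.card : ℝ≥0∞) * ENNReal.ofReal (η * r) ≤
      ∑ x ∈ σ, ∫⁻ s in Ioo (T - r ^ 2) T, ∫⁻ y in ball x r, F s y := by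
    rw [← nsmul_eq_mul, ← Finset.sum_const]
    exact Finset.sum_le_sum fun x hx => hconc x hx
  have hup : ∑ x ∈ σ, ∫⁻ s in Ioo (T - r ^ 2) T, ∫⁻ y in ball x r, F s y ≤
      ∫⁻ s in Ioo (T - r ^ 2) T, ∫⁻ x, ‖curl (u s) x‖ₑ ^ 2 := by
    refine (CountQuarterLaw.sum_lintegral_le _ σ _).trans ?_
    have h1 : ∫⁻ s in Ioo (T - r ^ 2) T, ∑ x ∈ σ, ∫⁻ y in ball x r, F s y ≤
        ∫⁻ s in Ioo (T - r ^ 2) T, ∫⁻ y, F s y := by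
      refine lintegral_mono fun s => ?_
      rw [← lintegral_biUnion_finset hdisj (fun x _ => measurableSet_ball)]
      exact setLIntegral_le_lintegral _ _
    refine h1.trans (setLIntegral_mono_ae' measurableSet_Ioo (ae_of_all _ fun t ht => ?_))
    have htI : t ∈ Ico 0 T := ⟨hr2.trans ht.1.le, ht.2⟩
    have hC2 : ContDiff ℝ 2 (u t) := (hsol.contDiff_velocity htI).of_le (by norm_cast)
    have hL2 : ∫⁻ x, ‖u t x‖ₑ ^ 2 < ⊤ :=
      lt_of_le_of_lt (SereginSverak2002.eEnergy_le hν.le hLH ⟨htI.1, htI.2.le⟩) ENNReal.ofReal_lt_top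
    exact lintegral_frobeniusNormSq_fderiv_le_lintegral_sq_norm_curl hC2 (hsol.divFree t htI) hL2
  exact hlow.trans (hup.trans hwin)

/-! ### The loud set is short: `N · r → 0` -/

/-- **Vanishing total length of the loud set.** Along a classical Leray–Hopf solution on `[0,T)` from a
rapidly decaying datum (`ν, T > 0`; NO Type-I hypothesis): for every `η > 0` and `ε > 0` there is
`r₁ > 0` such that at every scale `0 < r ≤ r₁` every `2r`-separated family `σ` of `η`-loud vertex-`T`
centres has `#σ · r ≤ ε`. Finite dissipation makes the last windows small
(`QuarterLawBackwardWindow.exists_window_lt`); the separated loud count is therefore `o(1/r)`.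
[folklore] -/
theorem loudLength_small (hν : 0 < ν) (hT : 0 < T)
    (hsol : IsClassicalNSSolutionOn (Ico 0 T) ν 0 u p) (hLH : IsLerayHopfOn T ν 0 (u 0) u)
    (hdec : HasRapidSpatialDecay (u 0)) {η : ℝ} (hη : 0 < η) {ε : ℝ} (hε : 0 < ε) :
    ∃ r₁ : ℝ, 0 < r₁ ∧ ∀ r : ℝ, 0 < r → r ≤ r₁ →
      ∀ σ : Finset (EuclideanSpace ℝ (Fin 3)),
        (∀ x ∈ σ, ∀ x' ∈ σ, x ≠ x' → 2 * r ≤ ‖x - x'‖) →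
        (∀ x ∈ σ, ENNReal.ofReal (η * r) ≤ ∫⁻ s in Ioo (T - r ^ 2) T, ∫⁻ y in ball x r,
          ENNReal.ofReal (frobeniusNormSq (fderiv ℝ (u s) y))) → (σ.card : ℝ) * r ≤ ε := by
  have hεη : (ENNReal.ofReal (η * ε)) ≠ 0 := by
    rw [ne_eq, ENNReal.ofReal_eq_zero, not_le]; positivity
  obtain ⟨a₁, ha₁, hwin⟩ := QuarterLawBackwardWindow.exists_window_lt hν hT hsol hLH hdec hεη
  -- `r₁ = √(T − a₁)`
  refine ⟨Real.sqrt (T - a₁), Real.sqrt_pos.2 (by linarith [ha₁.2]), fun r hr hrle σ hsep hconc => ?_⟩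
  have hr2 : r ^ 2 ≤ T - a₁ := by
    have := pow_le_pow_left₀ hr.le hrle 2
    rwa [Real.sq_sqrt (by linarith [ha₁.2])] at this
  have ha₁r : a₁ ≤ T - r ^ 2 := by linarith
  have hr2' : 0 ≤ T - r ^ 2 := ha₁.1.trans ha₁r
  have hwin' : ∫⁻ s in Ioo (T - r ^ 2) T, ∫⁻ x, ‖curl (u s) x‖ₑ ^ 2 ≤ ENNReal.ofReal (η * ε) :=
    (lintegral_mono_set (Ioo_subset_Ioo ha₁r le_rfl)).trans hwin.le
  have h := card_mul_scale_le_of_window hν hsol hLH hr2' hwin' σ hsep hconc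
  rw [← ENNReal.ofReal_natCast, ← ENNReal.ofReal_mul (Nat.cast_nonneg _),
    ENNReal.ofReal_le_ofReal_iff (by positivity)] at h
  -- `#σ · η r ≤ η ε`
  have h' : η * ((σ.card : ℝ) * r) ≤ η * ε := by nlinarith [h]
  exact le_of_mul_le_mul_left h' hη

/-- **The separated loud count is `o(1/r)`** (count form of `loudLength_small`): for `η, ε > 0` there is
`r₁ > 0` with `#σ ≤ ε / r` for every `2r`-separated `η`-loud family at every scale `0 < r ≤ r₁`. The
quarter law K1 asks for `O(1)` here (`quarterLawTypeI_iff_uniformConcentrationCountTypeI`); plain energy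
bookkeeping gives `o(1/r)` — one power short. [folklore] -/
theorem count_le_eps_div (hν : 0 < ν) (hT : 0 < T)
    (hsol : IsClassicalNSSolutionOn (Ico 0 T) ν 0 u p) (hLH : IsLerayHopfOn T ν 0 (u 0) u)
    (hdec : HasRapidSpatialDecay (u 0)) {η : ℝ} (hη : 0 < η) {ε : ℝ} (hε : 0 < ε) :
    ∃ r₁ : ℝ, 0 < r₁ ∧ ∀ r : ℝ, 0 < r → r ≤ r₁ →
      ∀ σ : Finset (EuclideanSpace ℝ (Fin 3)),
        (∀ x ∈ σ, ∀ x' ∈ σ, x ≠ x' → 2 * r ≤ ‖x - x'‖) →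
        (∀ x ∈ σ, ENNReal.ofReal (η * r) ≤ ∫⁻ s in Ioo (T - r ^ 2) T, ∫⁻ y in ball x r,
          ENNReal.ofReal (frobeniusNormSq (fderiv ℝ (u s) y))) → (σ.card : ℝ) ≤ ε / r := by
  obtain ⟨r₁, hr₁, h⟩ := loudLength_small hν hT hsol hLH hdec hη hε
  refine ⟨r₁, hr₁, fun r hr hrle σ hsep hconc => ?_⟩
  rw [le_div_iff₀ hr]
  exact h r hr hrle σ hsep hconc

/-! ### The violator: unboundedly many, linearly packed, short -/

/-- **Portrait of a K1-violator in cell currency.** Along a Type-I blow-up of K1's class (maximal classical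
solution on `[0,T)`, Leray–Hopf, rapidly decaying datum, sup-norm Type-I rate) violating the slice quarter
law, there are a threshold `η > 0` and packing constants `M, r₀ > 0` such that
(a) UNBOUNDED COUNT: for every `N` and `r' > 0` some scale `0 < r ≤ r'` carries a `2r`-separated `η`-loud
family with more than `N` members (contrapositive of the landed `stub_countQuarterLaw`);
(b) SHORT: for every `ε > 0`, at all small scales every such family has `#σ · r ≤ ε`;
(c) LINEARLY PACKED: at most `3M(A+1)/η` members of such a family lie in any ball of radius `A r`
(`(A+1) r ≤ r₀`). A statement about a hypothetical object; nothing is asserted to exist. [folklore] -/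
theorem violator_many_short (hν : 0 < ν) (hT : 0 < T)
    (hmax : IsMaximalSmoothSolution ν 0 u p T) (hLH : IsLerayHopfOn T ν 0 (u 0) u)
    (hdec : HasRapidSpatialDecay (u 0)) (hI : IsTypeIBlowup u T)
    (hviol : ¬ ∃ K : ℝ, ∀ t ∈ Ico 0 T,
      ∫⁻ x, ‖curl (u t) x‖ₑ ^ 2 ≤ ENNReal.ofReal (K / Real.sqrt (T - t))) :
    ∃ η M r₀ : ℝ, 0 < η ∧ 0 < M ∧ 0 < r₀ ∧
      -- (a) unbounded separated loud count as `r → 0`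
      (∀ (N : ℕ) (r' : ℝ), 0 < r' → ∃ (r : ℝ) (σ : Finset (EuclideanSpace ℝ (Fin 3))),
        0 < r ∧ r ≤ r' ∧ (∀ x ∈ σ, ∀ x' ∈ σ, x ≠ x' → 2 * r ≤ ‖x - x'‖) ∧
        (∀ x ∈ σ, ENNReal.ofReal (η * r) ≤ ∫⁻ s in Ioo (T - r ^ 2) T, ∫⁻ y in ball x r,
          ENNReal.ofReal (frobeniusNormSq (fderiv ℝ (u s) y))) ∧ N < σ.card) ∧
      -- (b) vanishing total length
      (∀ ε : ℝ, 0 < ε → ∃ r₁ : ℝ, 0 < r₁ ∧ ∀ r : ℝ, 0 < r → r ≤ r₁ →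
        ∀ σ : Finset (EuclideanSpace ℝ (Fin 3)),
          (∀ x ∈ σ, ∀ x' ∈ σ, x ≠ x' → 2 * r ≤ ‖x - x'‖) →
          (∀ x ∈ σ, ENNReal.ofReal (η * r) ≤ ∫⁻ s in Ioo (T - r ^ 2) T, ∫⁻ y in ball x r,
            ENNReal.ofReal (frobeniusNormSq (fderiv ℝ (u s) y))) → (σ.card : ℝ) * r ≤ ε) ∧
      -- (c) linear packing
      (∀ r A : ℝ, 0 < r → 0 ≤ A → (A + 1) * r ≤ r₀ →
        ∀ (x₀ : EuclideanSpace ℝ (Fin 3)) (σ : Finset (EuclideanSpace ℝ (Fin 3))),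
          (∀ x ∈ σ, ‖x - x₀‖ ≤ A * r) →
          (∀ x ∈ σ, ∀ x' ∈ σ, x ≠ x' → 2 * r ≤ ‖x - x'‖) →
          (∀ x ∈ σ, ENNReal.ofReal (η * r) ≤ ∫⁻ s in Ioo (T - r ^ 2) T, ∫⁻ y in ball x r,
            ENNReal.ofReal (frobeniusNormSq (fderiv ℝ (u s) y))) →
          (σ.card : ℝ) ≤ 3 * M * (A + 1) / η) := by
  classical
  -- (a): the count hypothesis of `stub_countQuarterLaw` must fail at some threshold
  have hnc : ¬ ∀ η : ℝ, 0 < η → ∃ N : ℕ, ∃ r₀ : ℝ, 0 < r₀ ∧ ∀ r : ℝ, 0 < r → r ≤ r₀ →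
      ∀ σ : Finset (EuclideanSpace ℝ (Fin 3)),
        (∀ x ∈ σ, ∀ x' ∈ σ, x ≠ x' → 2 * r ≤ ‖x - x'‖) →
        (∀ x ∈ σ, ENNReal.ofReal (η * r) ≤ ∫⁻ s in Ioo (T - r ^ 2) T, ∫⁻ y in ball x r,
          ENNReal.ofReal (frobeniusNormSq (fderiv ℝ (u s) y))) → σ.card ≤ N :=
    fun hc => hviol (CountQuarterLaw.stub_countQuarterLaw ν T hν hT u p hmax hLH hdec hI hc)
  push Not at hnc
  obtain ⟨η, hη, hbad⟩ := hnc
  obtain ⟨M, r₀, hM, hr₀, hpack⟩ := linearPacking_of_isTypeIBlowup hν hT hmax.1 hLH hdec hI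
  refine ⟨η, M, r₀, hη, hM, hr₀, fun N r' hr' => ?_,
    fun ε hε => loudLength_small hν hT hmax.1 hLH hdec hη hε, hpack η hη⟩
  obtain ⟨r, hr, hrle, σ, hsep, hconc, hN⟩ := hbad N r' hr'
  exact ⟨r, σ, hr, hrle, hsep, hconc, hN⟩

end QuarterLawLinearPacking

end Summit.NavierStokesRegularity.NavierStokesRegularity.Theorems

end
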